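import Literature.Analysis.FluidPDE.FluidComputer.MaskRefinement
import Literature.Analysis.FluidPDE.FluidComputer.GalerkinExistence
import HarnessLib

/-!
# The spill is controlled by the tail of the coarse run's own spectrum: `|P_k N_T[V](k)| ≤ 4|k| √(E_T · E_tail)`, hence fine − coarse is driven by the measured upper-band energy

PLACEMENT: cell-own elementary lemmas of `pub-fluidc` (topic `FluidComputer` under the host summit, per the hub's
2026-08-19 placement rule: new work under `Summits/<Summit>/<topic>/`, `Literature/` only for cited published results);
the vocabulary (`IsGalerkinSolution`, `spill`, `gronwallBound`, `Dealiasing.box`) is the Literature one, opened below.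

HONEST FRAMING (cell `pub-fluidc`, verbatim): *low prior, high value-of-information experiment on
Tao's machine paradigm; NOT a claim that NS blows up.* The object is the finite Galerkin system on a mode
set (`GalerkinEnergyBalance.IsGalerkinSolution`), exact arithmetic; nothing is said about the Navier–Stokes
PDE and no modulus is evaluated.

`MaskRefinement` showed that a coarse run (mask `T`) is an approximate solution of the fine system (mask
`S ⊇ T`) whose defect is its SPILL `spill T 0 V k = P_k N_T[V](k)` at the discarded wavevectors
`k ∈ S ∖ T`, and bounded fine − coarse (and the telescoped continuation) by `gronwallBound δ K ε` with `ε`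
a bound on that spill. This file bounds the spill by quantities every engine already logs:

* `l2`, `norm_kdot_le` (`|k·a| ≤ |k||a|`), `l2_leray_le` (**the Leray projection is an `ℓ²`
  contraction**, from `k · P_k a = 0`: `|P_k a|² = Re⟨P_k a, a⟩ ≤ |P_k a||a|`), `leray_sum_mul` (linearity),
  `spill_zero_eq_sum` (`P_k N_T[A](k) = −i Σ_{p∈T} (k·Â(k−p)) P_k Â(p)`), `norm_spill_le_sum`
  (**`|P_k N_T[A](k)_j| ≤ |k| Σ_{p∈T} |Â(k−p)||Â(p)|`**);
* `sum_l2_mul_l2_le_tail` — **TAIL SPLIT**: if every interacting pair `(p, k−p) ∈ T × T` reaching `k`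
  has a leg in `Tail ⊆ T`, then `Σ_{p∈T} |Â(k−p)||Â(p)| ≤ 4 √(E_T) √(E_Tail)` (two Cauchy–Schwarz sums,
  `sum_shift_le` for the re-indexing `p ↦ k − p`); `norm_spill_le_tail` — **`|spill| ≤ 4|k|√(E_T E_Tail)`**;
* `sub_not_mem_box`, `norm_spill_box_le` — THE ENGINES' FORM: for `A` supported in `box K` and any
  `k ∉ box(2H)`, `|P_k N_{box K}[A](k)_j| ≤ 4|k| √(E_{box K}(A)) √(E_{box K ∖ box H}(A))` — for the spill
  shells `box K′ ∖ box K` take `H = ⌊K/2⌋`: **the discarded nonlinearity is controlled by the energy in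
  the upper half (in sup-norm shells) of the retained band**;
* `dist_fine_coarse_box_le` — **THE LOGGABLE STATEMENT**: `box K ⊆ box K′`, unforced, `ν ≥ 0`, same
  datum of energy `≤ E₀`, `2H ≤ K`, upper-band energy `E_{box K∖box H}(V(s)) ≤ η` on `[t₀,t₁)` ⇒
  `‖U(t) − V(t)‖_∞ ≤ gronwallBound 0 K_{box K′,ν,√(2E₀)} (4√3 K′ √E₀ √η) (t − t₀)` on `[t₀, t₁]`.

Reading for the cell (information for GRID / REFEREE / dns-A / SCORER on the 'telescoped 512³→1024³
continuation' of EFFICIENCY S8; never a ruling): with `MaskRefinement.dist_telescoped_le` the continuation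
error is `gronwallBound 0 K ε (t₁ − t₀) e^{K(t−t₁)}` and by this file `ε ≤ 4√3 K′ √(E₀ · η)` where `η` is the
coarse run's energy above `|k|_∞ = ⌊K/2⌋` before the switch — a number read off the spectra rows the engines
already write (the same tail the `δ(t)·k_max` criterion of the cell's literature notes watches); the modulus
`K` stays the pessimistic global Lipschitz constant, so this fixes WHAT certifies 'resolved up to t₁' (small
upper-band energy of the coarse run), not a tolerance. [cite: HairerNorsettWanner1993, Thm. I.10.2 (10.14)]
for the Gronwall step; [cite: CanutoEtAl2007, §3.3.2 (2/3-rule paragraph)] for the masks; the estimates are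
elementary (Cauchy–Schwarz) [folklore]. No named facts (D-0026); 0 sorry.
-/

noncomputable section

namespace Summit.NavierStokesRegularity.FluidComputer

open Complex ComplexConjugate Finset Metric Set
open scoped BigOperators NNReal
open Literature.Analysis.FluidPDE.FluidComputer
open Literature.Analysis.FluidPDE.FluidComputer.ShellTransfer
open Literature.Analysis.FluidPDE.FluidComputer.ShellTransfer.GalerkinODE

namespace SpillBound

/-! ## Bounding the spill by the spectrum of the coarse run: `|spill(k)| ≤ 4|k| √(E_T · E_tail)` -/

/-- The explicit `ℓ²` norm on `ℂ³`, `|a| = √(Σ_j |a_j|²)`. [folklore] -/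
def l2 (a : Fin 3 → ℂ) : ℝ := Real.sqrt (∑ j, ‖a j‖ ^ 2)

/-- `0 ≤ |a|`. [folklore] -/
theorem l2_nonneg (a : Fin 3 → ℂ) : 0 ≤ l2 a := Real.sqrt_nonneg _

/-- `|a|² = Σ_j |a_j|²`. [folklore] -/
theorem l2_sq (a : Fin 3 → ℂ) : l2 a ^ 2 = ∑ j, ‖a j‖ ^ 2 :=
  Real.sq_sqrt (Finset.sum_nonneg fun _ _ => sq_nonneg _)

/-- Components are bounded by the `ℓ²` norm. [folklore] -/
theorem norm_apply_le_l2 (a : Fin 3 → ℂ) (j : Fin 3) : ‖a j‖ ≤ l2 a :=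
  Real.le_sqrt_of_sq_le
    (Finset.single_le_sum (f := fun i => ‖a i‖ ^ 2) (fun _ _ => sq_nonneg _) (Finset.mem_univ j))

/-- `|û(p)|² = 2 E(p)`. [folklore] -/
theorem l2_sq_coeff (A : FourierVelocity) (p : Fin 3 → ℤ) : l2 (A.coeff p) ^ 2 = 2 * modalEnergy A p := by
  rw [l2_sq]
  unfold modalEnergy
  simp_rw [Complex.normSq_eq_norm_sq]
  ring

/-- `|û(p)| = √(2 E(p))`. [folklore] -/
theorem l2_coeff (A : FourierVelocity) (p : Fin 3 → ℤ) :
    l2 (A.coeff p) = Real.sqrt (2 * modalEnergy A p) := by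
  rw [← l2_sq_coeff, Real.sqrt_sq (l2_nonneg _)]

/-- **Cauchy–Schwarz for `k · a`**: `|k · a| ≤ |k| |a|`. [folklore] -/
theorem norm_kdot_le (k : Fin 3 → ℤ) (b : Fin 3 → ℂ) : ‖kdot k b‖ ≤ Real.sqrt (knormSq k) * l2 b := by
  unfold kdot l2 knormSq
  calc ‖∑ i, ((k i : ℤ) : ℂ) * b i‖ ≤ ∑ i, ‖((k i : ℤ) : ℂ) * b i‖ := norm_sum_le _ _
    _ = ∑ i, |((k i : ℤ) : ℝ)| * ‖b i‖ := by
        refine Finset.sum_congr rfl fun i _ => ?_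
        rw [norm_mul, Complex.norm_intCast]
    _ ≤ Real.sqrt (∑ i, |((k i : ℤ) : ℝ)| ^ 2) * Real.sqrt (∑ i, ‖b i‖ ^ 2) :=
        Real.sum_mul_le_sqrt_mul_sqrt _ _ _
    _ = Real.sqrt (∑ i, ((k i : ℤ) : ℝ) ^ 2) * Real.sqrt (∑ i, ‖b i‖ ^ 2) := by simp_rw [sq_abs]

/-- **The Leray projection is an `ℓ²` contraction**: `|P_k a| ≤ |a|` (it is the orthogonal projection onto
`k^⊥`; proof: `k · P_k a = 0` gives `|P_k a|² = Re⟨P_k a, a⟩ ≤ |P_k a| |a|`). [folklore] -/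
theorem l2_leray_le (k : Fin 3 → ℤ) (b : Fin 3 → ℂ) : l2 (leray k b) ≤ l2 b := by
  set P := leray k b with hP
  have hk : ∑ j, ((k j : ℤ) : ℂ) * P j = 0 := kdot_leray k b
  -- `Σ |P_j|² = Re Σ conj(P_j) b_j`
  have h1 : (∑ j, ‖P j‖ ^ 2 : ℝ) = (∑ j, conj (P j) * b j).re := by
    have e : ∀ j, b j = P j + kdot k b / (knormSq k : ℂ) * ((k j : ℤ) : ℂ) := fun j => by
      rw [hP, leray_apply]; ring
    have h2 : ∑ j, conj (P j) * b j =
        ∑ j, conj (P j) * P j + kdot k b / (knormSq k : ℂ) * conj (∑ j, ((k j : ℤ) : ℂ) * P j) := by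
      rw [map_sum, Finset.mul_sum, ← Finset.sum_add_distrib]
      refine Finset.sum_congr rfl fun j _ => ?_
      rw [map_mul, map_intCast]
      conv_lhs => rw [e j]
      ring
    rw [h2, hk, map_zero, mul_zero, add_zero, Complex.re_sum]
    refine Finset.sum_congr rfl fun j _ => ?_
    rw [mul_comm, Complex.mul_conj, Complex.ofReal_re, Complex.normSq_eq_norm_sq]
  -- Cauchy–Schwarz
  have h3 : (∑ j, conj (P j) * b j).re ≤ l2 P * l2 b := by
    calc (∑ j, conj (P j) * b j).re ≤ ‖∑ j, conj (P j) * b j‖ := Complex.re_le_norm _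
      _ ≤ ∑ j, ‖conj (P j) * b j‖ := norm_sum_le _ _
      _ = ∑ j, ‖P j‖ * ‖b j‖ := by
          refine Finset.sum_congr rfl fun j _ => ?_
          rw [norm_mul, Complex.norm_conj]
      _ ≤ Real.sqrt (∑ j, ‖P j‖ ^ 2) * Real.sqrt (∑ j, ‖b j‖ ^ 2) := Real.sum_mul_le_sqrt_mul_sqrt _ _ _
  have h4 : l2 P ^ 2 ≤ l2 P * l2 b := by rw [l2_sq, h1]; exact h3
  rcases eq_or_lt_of_le (l2_nonneg P) with h0 | hpos
  · rw [← h0]; exact l2_nonneg b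
  · nlinarith

/-- `P_k` is linear over finite combinations: `P_k(Σ_p c_p v_p)_j = Σ_p c_p (P_k v_p)_j`. [folklore] -/
theorem leray_sum_mul {ι : Type*} (k : Fin 3 → ℤ) (s : Finset ι) (c : ι → ℂ) (v : ι → Fin 3 → ℂ)
    (j : Fin 3) : leray k (fun i => ∑ p ∈ s, c p * v p i) j = ∑ p ∈ s, c p * leray k (v p) j := by
  classical
  induction s using Finset.induction_on generalizing j with
  | empty =>
      simp only [Finset.sum_empty]
      exact congrFun (leray_zero k) j
  | insert a s ha ih =>
      simp only [Finset.sum_insert ha]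
      have e : (fun i => c a * v a i + ∑ p ∈ s, c p * v p i) =
          fun i => (fun i => c a * v a i) i + (fun i => ∑ p ∈ s, c p * v p i) i := rfl
      rw [e, leray_add]
      show leray k (fun i => c a * v a i) j + leray k (fun i => ∑ p ∈ s, c p * v p i) j = _
      rw [leray_const_mul, ih j]

/-- **The spill is a finite combination of projected coefficients**:
`P_k N_T[A](k)_j = -i Σ_{p∈T} (k · Â(k-p)) (P_k Â(p))_j` (linearity of `P_k`). [folklore] -/
theorem spill_zero_eq_sum (T : Finset (Fin 3 → ℤ)) (A : FourierVelocity) (k : Fin 3 → ℤ) (j : Fin 3) :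
    spill T (fun _ _ => 0) A k j = -I * ∑ p ∈ T, kdot k (A.coeff (k - p)) * leray k (A.coeff p) j := by
  rw [spill_apply]
  simp only [add_zero]
  have e : (fun i => advection A T k i) =
      fun i => ∑ p ∈ T, (-I * kdot k (A.coeff (k - p))) * A.coeff p i := by
    funext i
    unfold advection
    rw [Finset.mul_sum]
    refine Finset.sum_congr rfl fun p _ => ?_
    ring
  rw [e, leray_sum_mul, Finset.mul_sum]
  refine Finset.sum_congr rfl fun p _ => ?_
  ring

/-- **Pointwise spill bound**: `|P_k N_T[A](k)_j| ≤ |k| Σ_{p∈T} |Â(k-p)| |Â(p)|`. [folklore] -/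
theorem norm_spill_le_sum (T : Finset (Fin 3 → ℤ)) (A : FourierVelocity) (k : Fin 3 → ℤ) (j : Fin 3) :
    ‖spill T (fun _ _ => 0) A k j‖ ≤
      Real.sqrt (knormSq k) * ∑ p ∈ T, l2 (A.coeff (k - p)) * l2 (A.coeff p) := by
  rw [spill_zero_eq_sum, norm_mul, norm_neg, Complex.norm_I, one_mul, Finset.mul_sum]
  refine (norm_sum_le _ _).trans (Finset.sum_le_sum fun p _ => ?_)
  rw [norm_mul]
  have h1 := norm_kdot_le k (A.coeff (k - p))
  have h2 : ‖leray k (A.coeff p) j‖ ≤ l2 (A.coeff p) :=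
    (norm_apply_le_l2 _ j).trans (l2_leray_le k (A.coeff p))
  calc ‖kdot k (A.coeff (k - p))‖ * ‖leray k (A.coeff p) j‖
      ≤ (Real.sqrt (knormSq k) * l2 (A.coeff (k - p))) * l2 (A.coeff p) :=
        mul_le_mul h1 h2 (norm_nonneg _) (mul_nonneg (Real.sqrt_nonneg _) (l2_nonneg _))
    _ = Real.sqrt (knormSq k) * (l2 (A.coeff (k - p)) * l2 (A.coeff p)) := by ring

/-- Shifted sums over the support are dominated by the full sum: for `F ≥ 0` vanishing off `T`,
`Σ_{p∈T} F(k - p) ≤ Σ_{q∈T} F(q)`. [folklore] -/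
theorem sum_shift_le (T : Finset (Fin 3 → ℤ)) {F : (Fin 3 → ℤ) → ℝ} (hF : ∀ q, 0 ≤ F q)
    (hT : ∀ q ∉ T, F q = 0) (k : Fin 3 → ℤ) : ∑ p ∈ T, F (k - p) ≤ ∑ q ∈ T, F q := by
  have hinj : Set.InjOn (fun p : Fin 3 → ℤ => k - p) ↑T := fun p _ q _ h => by
    simpa using h
  rw [← Finset.sum_image (f := F) hinj]
  rw [← Finset.sum_filter_of_ne (p := fun q => q ∈ T) (fun q _ hq => by
    by_contra h; exact hq (hT q h))]
  exact Finset.sum_le_sum_of_subset_of_nonneg (fun q hq => (Finset.mem_filter.1 hq).2) fun q _ _ => hF q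

/-- `Σ_{p∈T} |Â(p)|² = 2 E_T`. [folklore] -/
theorem sum_l2_sq_coeff (A : FourierVelocity) (T : Finset (Fin 3 → ℤ)) :
    ∑ p ∈ T, l2 (A.coeff p) ^ 2 = 2 * truncEnergy A T := by
  unfold truncEnergy
  rw [Finset.mul_sum]
  exact Finset.sum_congr rfl fun p _ => l2_sq_coeff A p

/-- **TAIL SPLIT.** `A` supported in `T`, `Tail ⊆ T`, and `k` "far": whenever `p ∈ T ∖ Tail` then
`k - p ∉ T ∖ Tail` (every interacting pair reaching `k` has a leg in the tail). Then
`Σ_{p∈T} |Â(k-p)| |Â(p)| ≤ 4 √(E_T) √(E_Tail)`. [folklore] -/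
theorem sum_l2_mul_l2_le_tail (A : FourierVelocity) {T Tail : Finset (Fin 3 → ℤ)} (hTail : Tail ⊆ T)
    (hA : ∀ p ∉ T, A.coeff p = 0) {k : Fin 3 → ℤ}
    (hfar : ∀ p ∈ T, p ∉ Tail → k - p ∈ T → k - p ∈ Tail) :
    ∑ p ∈ T, l2 (A.coeff (k - p)) * l2 (A.coeff p) ≤
      4 * Real.sqrt (truncEnergy A T) * Real.sqrt (truncEnergy A Tail) := by
  classical
  -- the tail-restricted amplitude
  set t : (Fin 3 → ℤ) → ℝ := fun q => if q ∈ Tail then l2 (A.coeff q) else 0 with ht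
  have ht0 : ∀ q, 0 ≤ t q := fun q => by simp only [ht]; split_ifs <;> simp [l2_nonneg]
  have htT : ∀ q ∉ T, t q = 0 := fun q hq => by
    simp only [ht]; rw [if_neg fun h => hq (hTail h)]
  have hl2T : ∀ q ∉ T, l2 (A.coeff q) = 0 := fun q hq => by
    rw [hA q hq]; simp [l2]
  -- pointwise: each product has a leg in the tail
  have hpt : ∀ p ∈ T, l2 (A.coeff (k - p)) * l2 (A.coeff p) ≤
      l2 (A.coeff (k - p)) * t p + t (k - p) * l2 (A.coeff p) := by
    intro p hp
    by_cases h1 : p ∈ Tail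
    · have : t p = l2 (A.coeff p) := by simp only [ht]; rw [if_pos h1]
      rw [this]
      nlinarith [ht0 (k - p), l2_nonneg (A.coeff p)]
    · by_cases h2 : k - p ∈ T
      · have h3 := hfar p hp h1 h2
        have : t (k - p) = l2 (A.coeff (k - p)) := by simp only [ht]; rw [if_pos h3]
        rw [this]
        nlinarith [ht0 p, l2_nonneg (A.coeff (k - p))]
      · rw [hl2T (k - p) h2]
        simp only [zero_mul]
        nlinarith [ht0 (k - p), l2_nonneg (A.coeff p)]
  -- sum and Cauchy–Schwarz twice
  have hS1 : ∑ p ∈ T, l2 (A.coeff (k - p)) * t p ≤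
      Real.sqrt (2 * truncEnergy A T) * Real.sqrt (2 * truncEnergy A Tail) := by
    have cs := Real.sum_mul_le_sqrt_mul_sqrt T (fun p => l2 (A.coeff (k - p))) t
    have e1 : ∑ p ∈ T, l2 (A.coeff (k - p)) ^ 2 ≤ 2 * truncEnergy A T := by
      rw [← sum_l2_sq_coeff]
      exact sum_shift_le T (F := fun q => l2 (A.coeff q) ^ 2) (fun q => sq_nonneg _)
        (fun q hq => by show l2 (A.coeff q) ^ 2 = 0; rw [hl2T q hq]; simp) k
    have e2 : ∑ p ∈ T, t p ^ 2 = 2 * truncEnergy A Tail := by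
      rw [← sum_l2_sq_coeff, ← Finset.sum_subset hTail (fun q _ hq => by
        show t q ^ 2 = 0
        simp only [ht]; rw [if_neg hq]; simp)]
      refine Finset.sum_congr rfl fun q hq => ?_
      simp only [ht]; rw [if_pos hq]
    calc _ ≤ Real.sqrt (∑ p ∈ T, l2 (A.coeff (k - p)) ^ 2) * Real.sqrt (∑ p ∈ T, t p ^ 2) := cs
      _ ≤ Real.sqrt (2 * truncEnergy A T) * Real.sqrt (2 * truncEnergy A Tail) := by
          rw [e2]
          exact mul_le_mul_of_nonneg_right (Real.sqrt_le_sqrt e1) (Real.sqrt_nonneg _)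
  have hS2 : ∑ p ∈ T, t (k - p) * l2 (A.coeff p) ≤
      Real.sqrt (2 * truncEnergy A Tail) * Real.sqrt (2 * truncEnergy A T) := by
    have cs := Real.sum_mul_le_sqrt_mul_sqrt T (fun p => t (k - p)) fun p => l2 (A.coeff p)
    have e1 : ∑ p ∈ T, t (k - p) ^ 2 ≤ 2 * truncEnergy A Tail := by
      have h := sum_shift_le T (F := fun q => t q ^ 2) (fun q => sq_nonneg _)
        (fun q hq => by rw [htT q hq]; simp) k
      refine h.trans (le_of_eq ?_)
      rw [← sum_l2_sq_coeff, ← Finset.sum_subset hTail (fun q _ hq => by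
        show t q ^ 2 = 0
        simp only [ht]; rw [if_neg hq]; simp)]
      refine Finset.sum_congr rfl fun q hq => ?_
      simp only [ht]; rw [if_pos hq]
    have e2 : ∑ p ∈ T, l2 (A.coeff p) ^ 2 = 2 * truncEnergy A T := sum_l2_sq_coeff A T
    calc _ ≤ Real.sqrt (∑ p ∈ T, t (k - p) ^ 2) * Real.sqrt (∑ p ∈ T, l2 (A.coeff p) ^ 2) := cs
      _ ≤ Real.sqrt (2 * truncEnergy A Tail) * Real.sqrt (2 * truncEnergy A T) := by
          rw [e2]
          exact mul_le_mul_of_nonneg_right (Real.sqrt_le_sqrt e1) (Real.sqrt_nonneg _)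
  have hET : 0 ≤ truncEnergy A T := Finset.sum_nonneg fun q _ => modalEnergy_nonneg A q
  have hETail : 0 ≤ truncEnergy A Tail := Finset.sum_nonneg fun q _ => modalEnergy_nonneg A q
  have hsq : Real.sqrt (2 * truncEnergy A T) * Real.sqrt (2 * truncEnergy A Tail) =
      2 * Real.sqrt (truncEnergy A T) * Real.sqrt (truncEnergy A Tail) := by
    rw [Real.sqrt_mul (by norm_num : (0:ℝ) ≤ 2), Real.sqrt_mul (by norm_num : (0:ℝ) ≤ 2)]
    have h2 : Real.sqrt 2 * Real.sqrt 2 = 2 := Real.mul_self_sqrt (by norm_num)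
    calc Real.sqrt 2 * Real.sqrt (truncEnergy A T) * (Real.sqrt 2 * Real.sqrt (truncEnergy A Tail))
        = (Real.sqrt 2 * Real.sqrt 2) * Real.sqrt (truncEnergy A T) * Real.sqrt (truncEnergy A Tail) := by ring
      _ = _ := by rw [h2]
  calc ∑ p ∈ T, l2 (A.coeff (k - p)) * l2 (A.coeff p)
      ≤ ∑ p ∈ T, (l2 (A.coeff (k - p)) * t p + t (k - p) * l2 (A.coeff p)) := Finset.sum_le_sum hpt
    _ = ∑ p ∈ T, l2 (A.coeff (k - p)) * t p + ∑ p ∈ T, t (k - p) * l2 (A.coeff p) :=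
        Finset.sum_add_distrib
    _ ≤ Real.sqrt (2 * truncEnergy A T) * Real.sqrt (2 * truncEnergy A Tail) +
          Real.sqrt (2 * truncEnergy A Tail) * Real.sqrt (2 * truncEnergy A T) := add_le_add hS1 hS2
    _ = 4 * Real.sqrt (truncEnergy A T) * Real.sqrt (truncEnergy A Tail) := by
        rw [mul_comm (Real.sqrt (2 * truncEnergy A Tail)), hsq]; ring

/-- **SPILL ≤ 4|k| √(E_T · E_Tail)** — the discarded nonlinearity of a `T`-supported field at a far
wavevector `k` is controlled by the energy in the TAIL of its own spectrum. [folklore] -/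
theorem norm_spill_le_tail (A : FourierVelocity) {T Tail : Finset (Fin 3 → ℤ)} (hTail : Tail ⊆ T)
    (hA : ∀ p ∉ T, A.coeff p = 0) {k : Fin 3 → ℤ}
    (hfar : ∀ p ∈ T, p ∉ Tail → k - p ∈ T → k - p ∈ Tail) (j : Fin 3) :
    ‖spill T (fun _ _ => 0) A k j‖ ≤
      4 * Real.sqrt (knormSq k) * Real.sqrt (truncEnergy A T) * Real.sqrt (truncEnergy A Tail) := by
  have h1 := norm_spill_le_sum T A k j
  have h2 := sum_l2_mul_l2_le_tail A hTail hA hfar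
  calc _ ≤ Real.sqrt (knormSq k) * ∑ p ∈ T, l2 (A.coeff (k - p)) * l2 (A.coeff p) := h1
    _ ≤ Real.sqrt (knormSq k) * (4 * Real.sqrt (truncEnergy A T) * Real.sqrt (truncEnergy A Tail)) :=
        mul_le_mul_of_nonneg_left h2 (Real.sqrt_nonneg _)
    _ = _ := by ring

/-- Boxes: if `k ∉ box(2H)` and `p ∈ box H` then `k - p ∉ box H`. [folklore] -/
theorem sub_not_mem_box {H : ℕ} {k p : Fin 3 → ℤ} (hk : k ∉ Dealiasing.box (2 * H))
    (hp : p ∈ Dealiasing.box H) : k - p ∉ Dealiasing.box H := by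
  intro h
  apply hk
  rw [Dealiasing.mem_box] at hp h ⊢
  intro i
  have h1 := hp i
  have h2 := h i
  rw [Pi.sub_apply] at h2
  push_cast
  rw [abs_le] at h1 h2 ⊢
  constructor <;> linarith [h1.1, h1.2, h2.1, h2.2]

/-- **THE ENGINES' FORM.** A field supported in the mask `box K`; at every wavevector OUTSIDE `box(2H)`
(for the spill shells `box K′ ∖ box K` take `H = ⌊K/2⌋`) the spill is bounded by the energy in the upper part
`box K ∖ box H` of the field's own retained band:
`|P_k N_{box K}[A](k)_j| ≤ 4 |k| √(E_{box K}(A)) · √(E_{box K ∖ box H}(A))`. [folklore] -/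
theorem norm_spill_box_le (A : FourierVelocity) {K H : ℕ} (hA : ∀ p ∉ Dealiasing.box K, A.coeff p = 0)
    {k : Fin 3 → ℤ} (hk : k ∉ Dealiasing.box (2 * H)) (j : Fin 3) :
    ‖spill (Dealiasing.box K) (fun _ _ => 0) A k j‖ ≤
      4 * Real.sqrt (knormSq k) * Real.sqrt (truncEnergy A (Dealiasing.box K)) *
        Real.sqrt (truncEnergy A (Dealiasing.box K \ Dealiasing.box H)) := by
  refine norm_spill_le_tail A Finset.sdiff_subset hA (fun p hp hpt hkp => ?_) j
  rw [Finset.mem_sdiff, not_and, not_not] at hpt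
  exact Finset.mem_sdiff.2 ⟨hkp, sub_not_mem_box hk (hpt hp)⟩

/-- Boxes are nested: `box K ⊆ box K'` for `K ≤ K'`. [folklore] -/
theorem box_subset_box {K K' : ℕ} (h : K ≤ K') : Dealiasing.box K ⊆ Dealiasing.box K' := by
  intro k hk
  rw [Dealiasing.mem_box] at hk ⊢
  intro i
  exact (hk i).trans (by exact_mod_cast h)

/-- On the box, `|k| ≤ √3 K'`: `knormSq k ≤ 3 K'²`. [folklore] -/
theorem knormSq_le_of_mem_box {K' : ℕ} {k : Fin 3 → ℤ} (hk : k ∈ Dealiasing.box K') :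
    knormSq k ≤ 3 * (K' : ℝ) ^ 2 := by
  rw [Dealiasing.mem_box] at hk
  unfold knormSq
  have h : ∀ i, ((k i : ℤ) : ℝ) ^ 2 ≤ (K' : ℝ) ^ 2 := by
    intro i
    have h1 : |((k i : ℤ) : ℝ)| ≤ (K' : ℝ) := by exact_mod_cast hk i
    have h2 : 0 ≤ (K' : ℝ) := Nat.cast_nonneg _
    rw [← sq_abs]
    exact pow_le_pow_left₀ (abs_nonneg _) h1 2
  calc ∑ i, ((k i : ℤ) : ℝ) ^ 2 ≤ ∑ _i : Fin 3, (K' : ℝ) ^ 2 := Finset.sum_le_sum fun i _ => h i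
    _ = 3 * (K' : ℝ) ^ 2 := by simp [Finset.sum_const, Finset.card_univ, Fintype.card_fin]

/-- **THE LOGGABLE FORM (masks `box K ⊆ box K'`, unforced, same datum).** Let `V` be the coarse run
(`box K`), `U` the fine run (`box K'`, `K ≤ K'`), both unforced with `ν ≥ 0`, from the same state of energy
`≤ E₀` at `t₀`; let `2H ≤ K` and suppose the coarse run's UPPER-BAND ENERGY `E_{box K ∖ box H}(V(s)) ≤ η` for
`s ∈ [t₀, t₁)`. Then on `[t₀, t₁]`
`‖U(t) − V(t)‖_∞ ≤ gronwallBound 0 K_{S,ν,√(2E₀)} (4√3 K′ √E₀ √η) (t − t₀)`: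
the fine–coarse discrepancy is driven by the measured tail energy of the coarse run and nothing else
(amplified by the fine system's modulus, which is not evaluated). [folklore] -/
theorem dist_fine_coarse_box_le {U V : ℝ → FourierVelocity} {K K' H : ℕ} (hKK : K ≤ K') (hH : 2 * H ≤ K)
    {ν : ℝ} (hν : 0 ≤ ν) {c c' : ℝ → (Fin 3 → ℤ) → ℂ}
    (hU : IsGalerkinSolution U (Dealiasing.box K') ν c fun _ _ _ => 0)
    (hV : IsGalerkinSolution V (Dealiasing.box K) ν c' fun _ _ _ => 0)
    (hsU : IsSupportedOn U (Dealiasing.box K')) (hsV : IsSupportedOn V (Dealiasing.box K))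
    {t₀ t₁ E₀ η : ℝ} (h0 : U t₀ = V t₀)
    (hE : truncEnergy (V t₀) (Dealiasing.box K) ≤ E₀)
    (htail : ∀ s ∈ Ico t₀ t₁, truncEnergy (V s) (Dealiasing.box K \ Dealiasing.box H) ≤ η)
    {t : ℝ} (ht : t ∈ Icc t₀ t₁) :
    dist (restrict (Dealiasing.box K') (U t)) (restrict (Dealiasing.box K') (V t)) ≤
      gronwallBound 0 (galerkinLipConst (Dealiasing.box K') ν (Real.sqrt (2 * E₀)))
        (4 * (Real.sqrt 3 * K') * Real.sqrt E₀ * Real.sqrt η) (t - t₀) := by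
  have hε : 0 ≤ 4 * (Real.sqrt 3 * K') * Real.sqrt E₀ * Real.sqrt η := by positivity
  refine dist_fine_coarse_le_of_energy_le (Dealiasing.box K') (box_subset_box hKK) hν hU hV hsU hsV hε h0 hE
    (fun s hs k hk hkT j => ?_) ht
  -- the spill at `k ∈ box K' \ box K` via the tail bound with `Tail = box K \ box H`
  have hk2 : k ∉ Dealiasing.box (2 * H) := fun h => hkT (box_subset_box hH h)
  have h1 := norm_spill_box_le (V s) (H := H) (hsV s) hk2 j
  have hk' : Real.sqrt (knormSq k) ≤ Real.sqrt 3 * K' := by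
    rw [show Real.sqrt 3 * (K' : ℝ) = Real.sqrt (3 * (K' : ℝ) ^ 2) by
      rw [Real.sqrt_mul (by norm_num), Real.sqrt_sq (Nat.cast_nonneg _)]]
    exact Real.sqrt_le_sqrt (knormSq_le_of_mem_box hk)
  have hEs : truncEnergy (V s) (Dealiasing.box K) ≤ E₀ := (truncEnergy_antitone hν hV hs.1).trans hE
  have h2 : Real.sqrt (truncEnergy (V s) (Dealiasing.box K)) ≤ Real.sqrt E₀ := Real.sqrt_le_sqrt hEs
  have h3 : Real.sqrt (truncEnergy (V s) (Dealiasing.box K \ Dealiasing.box H)) ≤ Real.sqrt η :=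
    Real.sqrt_le_sqrt (htail s hs)
  calc _ ≤ 4 * Real.sqrt (knormSq k) * Real.sqrt (truncEnergy (V s) (Dealiasing.box K)) *
        Real.sqrt (truncEnergy (V s) (Dealiasing.box K \ Dealiasing.box H)) := h1
    _ ≤ 4 * (Real.sqrt 3 * K') * Real.sqrt E₀ * Real.sqrt η := by
        gcongr

end SpillBound

end Summit.NavierStokesRegularity.FluidComputer

end
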